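import Literature.NumberTheory.LFunctions.Zhang2022.Section2SecondOrder

/-!
# Zhang (2022) §2/§11: the second probe `J₂` as a free parameter — the exact skeleton

Companion to `Section2Assembly` / `Section2SecondOrder` (repair cell `pub-zhang`: audit + repair
census of Y. Zhang, *Discrete mean estimates and the Landau–Siegel zero*, arXiv:2211.02515v1 (2022)
[Zhang2022LandauSiegel]; the cell's verdict on that manuscript is NEGATIVE — the printed inequality
(8.24) fails, `Zhang2022.not_ineq824` — and **this file makes no claim about its Theorems 1–2 and
no claim about Landau–Siegel zeros**). Everything here is finite-sum algebra over the datum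
`EndgameData` of `Section2Assembly` (weights `𝔠* ≥ 0` (Lemma 2.3), `ω > 0`, `|Z| = 1`, arbitrary
complex values `H₁ H₂ J₁ J₂`). No asymptotics, no number theory.

In (2.30) the manuscript fixes the second probe
`J₂(s,ψ) = Σ ψχ(n) n^{-s} f̃(log n/log P + 0.004 − α̃)`, `α̃ = log(Dt₀)/log P`, as the
functional-equation mirror of `J₁` of (2.29): this choice is what makes
`Ξ₃* = Σ𝔠*|J₁ − ZJ̄₂||H₂|ω = o(𝔞𝔓)` (Proposition 2.6), proved in §11 through "By the result of
Section 9, `Ξ₁₂ ≪ 𝔞𝔓`. Hence, by Cauchy's inequality, the proof of Proposition 2.6 is reduced to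
showing that `Σ𝔠*|J₁ − Z(ρ,ψχ)J₂(1−ρ,ψ̄)|²ω(ρ) = o(𝔞𝔓)` (11.1)". The cell's ALT seat 2 (alternative
auxiliary parameters at the failing step, `b2b-zhang-alt-2/ALT-2.md` §11) asks what the §2 skeleton
yields when `J₂` is ANY other Dirichlet polynomial (other shift, other length or smoothing, or
`J₂ = 0`): then the left side `𝔇_J` of (11.1) has a main term `δ·𝔞𝔓` with `δ ≥ 0`, Proposition 2.6
is replaced by §11's own Cauchy bound `Ξ₃* ≤ √(Ξ₁₂·𝔇_J)`, and the lower bound `|Ξ₁*| ≥ d𝔞𝔓` of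
Proposition 2.4 changes too (`d = |𝔡′+𝔡|` of (10.17); the `H̄₂J₂`-mean
`Θ₁(𝐚₁₄,𝐚₂₂) + conj Θ₁(𝐚₁₂,𝐚₁₄)` of (10.1) contributes all of `𝔡′` and the `d₅ⱼ, d₆ⱼ` half of `𝔡`
((10.14)–(10.16)), and `𝐚₁₄` is `J₂`'s coefficient sequence).

**Proved here (axioms `propext`, `Classical.choice`, `Quot.sound`).** With
`𝔇_J := Σ𝔠*|J₁ − ZJ̄₂|²ω` (`afeDefectForm`, the left side of (11.1)):
* `xiStar3_sq_le`, `xiStar3_le_sqrt` — §11's Cauchy step `Ξ₃* ≤ √(Ξ₁₂·𝔇_J)`;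
  `norm_afeDefectCross_le_sqrt` — hence `|δ_×| ≤ √(Ξ₁₂·𝔇_J)` for the AFE-defect cross mean `δ_×` of
  `Section2SecondOrder` (`|δ_×| ≤ Ξ₃*`).
* `norm_xiStar1_le_sqrt_add_sqrt` — **(2.18) with both Cauchy steps:
  `|Ξ₁*| ≤ √(Ξ₁·Ξ_J) + √(Ξ₁₂·𝔇_J)` for EVERY datum**, i.e. for every choice of `J₂` whatsoever.
* `xiStar3_le_sqrt_mul`, `le_sqrt_add_sqrt_of_skeleton`, `false_of_closing_probe` — the closing
  condition of the skeleton with a free second probe: the six inputs `|Ξ₁*| ≥ d𝔞𝔓`, `Ξ₁ ≤ q𝔞𝔓`,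
  `Ξ_J ≤ c_J𝔞𝔓`, `Ξ₁₂ ≤ c₂𝔞𝔓`, `𝔇_J ≤ δ𝔞𝔓` and (2.18) are contradictory as soon as
  `√(q·c_J) + √(c₂·δ) < d` — the tolerance `ε` of `Section2Assembly.EndgameData.false_of_closing`
  that a free `J₂` affords is exactly `ε = √(c₂δ)`; Proposition 2.6 is the case `δ → 0`.
* `probeModel`, `probeModel_xiStar1`, …, **`exists_consistent_probe`** — conversely, if
  `d ≤ √(q·c_J) + √(c₂·δ)` then ONE index with `𝔠* = 1`, `ω = 𝔞𝔓`, `Z = 1`, `H₁ = √q − √c₂`,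
  `H₂ = √c₂`, `J₁ = √c_J`, `J₂ = √c_J + √δ` realises all six inputs at once, with
  `Ξ₃* = √(c₂δ)·𝔞𝔓` (equality in §11's Cauchy step) and (2.18) an equality: the generalised
  closing condition is NECESSARY AND SUFFICIENT for the skeleton to extract a contradiction from
  main-order constants of the six means — exactly as `Section2Assembly.exists_consistent` for the
  printed (`δ = 0`) skeleton.

The main-order half — that constants of polar provenance always satisfy
`d ≤ √(q·c_J) + √(c₂·δ)`, for every pair of probe profiles, so that the free second probe is never
a lever at main order — is `MainTermFormProbePair.not_closing_of_probePair`. All declarations are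
elementary and tagged `[folklore]` unless they transcribe a display of the manuscript.
-/

noncomputable section

open Complex Real ComplexConjugate Finset

namespace Literature.NumberTheory.LFunctions.Zhang2022

namespace EndgameData

variable {ι : Type*} [Fintype ι] (E : EndgameData ι)

/-! ## The left side of (11.1) and §11's Cauchy step -/

/-- The AFE-defect mean `𝔇_J := Σ 𝔠*|J₁ − ZJ̄₂|²ω` — the left side of (11.1) (`J₂(1−ρ,ψ̄) = J̄₂`
on the critical line for real `f̃`), i.e. the form (2.16) at the test function `J₁ − ZJ̄₂`.
Proposition 2.6 is the statement that its main term vanishes for the mirrored `J₂` of (2.30).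
[cite: Zhang2022LandauSiegel, §11 (11.1)] -/
def afeDefectForm : ℝ := ∑ i, E.cstar i * ‖E.J₁ i - E.Z i * conj (E.J₂ i)‖ ^ 2 * E.omega i

/-- `𝔇_J` is (2.16) with `𝔥 = J₁ − ZJ̄₂`. [folklore] -/
theorem afeDefectForm_eq_form216 :
    E.afeDefectForm = E.form216 fun i => E.J₁ i - E.Z i * conj (E.J₂ i) := rfl

/-- `𝔇_J ≥ 0` ((2.16)). [folklore] -/
theorem afeDefectForm_nonneg : 0 ≤ E.afeDefectForm := E.form216_nonneg _

/-- `Ξ₁₂ ≥ 0` ((2.16) at `𝔥 = H₂`). [folklore] -/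
theorem xi12_nonneg : 0 ≤ E.xi12 := by
  rw [show E.xi12 = E.form216 E.H₂ from rfl]
  exact E.form216_nonneg _

/-- **§11, first step** ("By the result of Section 9, `Ξ₁₂ ≪ 𝔞𝔓`. Hence, by Cauchy's inequality,
the proof of Proposition 2.6 is reduced to showing (11.1)"): `(Ξ₃*)² ≤ Ξ₁₂ · 𝔇_J` (weighted
Cauchy–Schwarz, weights `𝔠*ω ≥ 0`). [cite: Zhang2022LandauSiegel, §11, reduction of Prop. 2.6 to (11.1)] -/
theorem xiStar3_sq_le : E.xiStar3 ^ 2 ≤ E.xi12 * E.afeDefectForm := by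
  unfold xiStar3 xi12 afeDefectForm
  refine Finset.sum_sq_le_sum_mul_sum_of_sq_le_mul _ (fun i _ => ?_) (fun i _ => ?_)
    (fun i _ => le_of_eq ?_)
  · exact mul_nonneg (mul_nonneg (E.cstar_nonneg i) (sq_nonneg _)) (E.omega_pos i).le
  · exact mul_nonneg (mul_nonneg (E.cstar_nonneg i) (sq_nonneg _)) (E.omega_pos i).le
  · ring

/-- `Ξ₃* ≤ √(Ξ₁₂ · 𝔇_J)`. [cite: Zhang2022LandauSiegel, §11, reduction of Prop. 2.6 to (11.1)] -/
theorem xiStar3_le_sqrt : E.xiStar3 ≤ Real.sqrt (E.xi12 * E.afeDefectForm) :=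
  calc E.xiStar3 = Real.sqrt (E.xiStar3 ^ 2) := (Real.sqrt_sq E.xiStar3_nonneg).symm
    _ ≤ Real.sqrt (E.xi12 * E.afeDefectForm) := Real.sqrt_le_sqrt E.xiStar3_sq_le

/-- Hence `|δ_×| ≤ √(Ξ₁₂ · 𝔇_J)` for the AFE-defect cross mean `δ_× = Σ𝔠* H̄₂(J₂ − ZJ̄₁)ω` of
`Section2SecondOrder` (there `|δ_×| ≤ Ξ₃*`). [folklore] -/
theorem norm_afeDefectCross_le_sqrt :
    ‖E.afeDefectCross‖ ≤ Real.sqrt (E.xi12 * E.afeDefectForm) :=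
  E.norm_afeDefectCross_le_xiStar3.trans E.xiStar3_le_sqrt

/-- **(2.18) with both Cauchy steps**: `|Ξ₁*| ≤ √(Ξ₁·Ξ_J) + √(Ξ₁₂·𝔇_J)` — for every datum, in
particular for EVERY choice of the second probe `J₂` (mirrored as in (2.30) or not).
[cite: Zhang2022LandauSiegel, §2 (2.18), remark after Prop. 2.6; §11 (11.1)] -/
theorem norm_xiStar1_le_sqrt_add_sqrt :
    ‖E.xiStar1‖ ≤ Real.sqrt (E.xi1 * E.xiJ) + Real.sqrt (E.xi12 * E.afeDefectForm) :=
  E.norm_xiStar1_le.trans (add_le_add E.xiStar2_le_sqrt E.xiStar3_le_sqrt)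

/-! ## The closing condition with a free second probe -/

/-- Threshold form of §11's Cauchy step: `Ξ₁₂ ≤ c₂𝔞𝔓` and `𝔇_J ≤ δ𝔞𝔓` give `Ξ₃* ≤ √(c₂·δ)·𝔞𝔓`:
the tolerance `ε` of `Section2Assembly.EndgameData.false_of_closing` that a free second probe affords
is `ε = √(c₂δ)`. [folklore] -/
theorem xiStar3_le_sqrt_mul {aP c₂ δ : ℝ} (haP : 0 < aP) (h12 : E.xi12 ≤ c₂ * aP)
    (h111 : E.afeDefectForm ≤ δ * aP) : E.xiStar3 ≤ Real.sqrt (c₂ * δ) * aP := by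
  have h12nn := E.xi12_nonneg
  have hDnn := E.afeDefectForm_nonneg
  have hc₂ : 0 ≤ c₂ := by nlinarith
  have hδ : 0 ≤ δ := by nlinarith
  calc E.xiStar3 ≤ Real.sqrt (E.xi12 * E.afeDefectForm) := E.xiStar3_le_sqrt
    _ ≤ Real.sqrt (c₂ * aP * (δ * aP)) :=
        Real.sqrt_le_sqrt (mul_le_mul h12 h111 hDnn (h12nn.trans h12))
    _ = Real.sqrt (c₂ * δ) * aP := by
        rw [show c₂ * aP * (δ * aP) = c₂ * δ * (aP * aP) by ring,
          Real.sqrt_mul (mul_nonneg hc₂ hδ), Real.sqrt_mul_self haP.le]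

/-- **The closing condition with a free second probe.** If `|Ξ₁*| ≥ d·𝔞𝔓` (Prop. 2.4-type:
`d = |𝔡′+𝔡|` of (10.17), whose `H̄₂J₂`-part — `𝔡′` and the `d₅ⱼ, d₆ⱼ` terms of `𝔡`, (10.14)–(10.16) —
depends on `J₂`), `Ξ₁ ≤ q·𝔞𝔓`
((2.32)-type), `Ξ_J ≤ c_J·𝔞𝔓` ((2.33)-type), `Ξ₁₂ ≤ c₂·𝔞𝔓` (§9) and `𝔇_J ≤ δ·𝔞𝔓` ((11.1)-type),
then (2.18) forces `d ≤ √(q·c_J) + √(c₂·δ)`. [folklore] -/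
theorem le_sqrt_add_sqrt_of_skeleton {aP d q cJ c₂ δ : ℝ} (haP : 0 < aP)
    (h24 : d * aP ≤ ‖E.xiStar1‖) (h232 : E.xi1 ≤ q * aP) (h233 : E.xiJ ≤ cJ * aP)
    (h12 : E.xi12 ≤ c₂ * aP) (h111 : E.afeDefectForm ≤ δ * aP) :
    d ≤ Real.sqrt (q * cJ) + Real.sqrt (c₂ * δ) :=
  E.le_sqrt_add_of_skeleton haP h24 h232 h233 (E.xiStar3_le_sqrt_mul haP h12 h111)

/-- Hence the six inputs are contradictory as soon as `√(q·c_J) + √(c₂·δ) < d`. [folklore] -/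
theorem false_of_closing_probe {aP d q cJ c₂ δ : ℝ} (haP : 0 < aP)
    (hclose : Real.sqrt (q * cJ) + Real.sqrt (c₂ * δ) < d)
    (h24 : d * aP ≤ ‖E.xiStar1‖) (h232 : E.xi1 ≤ q * aP) (h233 : E.xiJ ≤ cJ * aP)
    (h12 : E.xi12 ≤ c₂ * aP) (h111 : E.afeDefectForm ≤ δ * aP) : False :=
  (lt_irrefl d) ((E.le_sqrt_add_sqrt_of_skeleton haP h24 h232 h233 h12 h111).trans_lt hclose)

end EndgameData

/-! ## Consistency: when `d ≤ √(q·c_J) + √(c₂·δ)` the skeleton yields nothing -/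

/-- The one-term probe datum: `𝔠* = 1`, `ω = 𝔞𝔓`, `Z = 1`, `H₁ = √q − √c₂`, `H₂ = √c₂`, `J₁ = √c_J`,
`J₂ = √c_J + √δ`. [folklore] -/
def probeModel (q cJ c₂ δ aP : ℝ) (haP : 0 < aP) : EndgameData Unit where
  cstar := fun _ => 1
  omega := fun _ => aP
  H₁ := fun _ => ((Real.sqrt q - Real.sqrt c₂ : ℝ) : ℂ)
  H₂ := fun _ => (Real.sqrt c₂ : ℂ)
  J₁ := fun _ => (Real.sqrt cJ : ℂ)
  J₂ := fun _ => ((Real.sqrt cJ + Real.sqrt δ : ℝ) : ℂ)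
  Z := fun _ => 1
  cstar_nonneg := fun _ => zero_le_one
  omega_pos := fun _ => haP
  norm_Z := fun _ => norm_one

section ProbeModel

variable {q cJ c₂ δ aP : ℝ} (hq : 0 ≤ q) (hcJ : 0 ≤ cJ) (hc₂ : 0 ≤ c₂) (hδ : 0 ≤ δ) (haP : 0 < aP)

/-- `Ξ₁* = (√(q·c_J) + √(c₂·δ))·𝔞𝔓` for the probe datum. [folklore] -/
theorem probeModel_xiStar1 (hq : 0 ≤ q) (hc₂ : 0 ≤ c₂) (haP : 0 < aP) :
    (probeModel q cJ c₂ δ aP haP).xiStar1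
      = (((Real.sqrt (q * cJ) + Real.sqrt (c₂ * δ)) * aP : ℝ) : ℂ) := by
  simp only [EndgameData.xiStar1, probeModel, Finset.univ_unique, Finset.sum_singleton,
    Complex.conj_ofReal, Complex.ofReal_one, one_mul]
  rw [Real.sqrt_mul hq, Real.sqrt_mul hc₂]
  push_cast
  ring

/-- `|Ξ₁*| = (√(q·c_J) + √(c₂·δ))·𝔞𝔓`. [folklore] -/
theorem probeModel_norm_xiStar1 (hq : 0 ≤ q) (hc₂ : 0 ≤ c₂) (haP : 0 < aP) :
    ‖(probeModel q cJ c₂ δ aP haP).xiStar1‖ = (Real.sqrt (q * cJ) + Real.sqrt (c₂ * δ)) * aP := by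
  rw [probeModel_xiStar1 hq hc₂ haP, Complex.norm_real, Real.norm_of_nonneg (by positivity)]

/-- `Ξ₁ = q·𝔞𝔓`. [folklore] -/
theorem probeModel_xi1 (hq : 0 ≤ q) (haP : 0 < aP) : (probeModel q cJ c₂ δ aP haP).xi1 = q * aP := by
  have h : ((Real.sqrt q - Real.sqrt c₂ : ℝ) : ℂ) + 1 * conj (Real.sqrt c₂ : ℂ) = (Real.sqrt q : ℂ) := by
    rw [Complex.conj_ofReal]; push_cast; ring
  simp only [EndgameData.xi1, probeModel, Finset.univ_unique, Finset.sum_singleton, one_mul]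
  rw [one_mul] at h
  rw [h, Complex.norm_real, Real.norm_of_nonneg (Real.sqrt_nonneg _), Real.sq_sqrt hq]

/-- `Ξ_J = c_J·𝔞𝔓`. [folklore] -/
theorem probeModel_xiJ (hcJ : 0 ≤ cJ) (haP : 0 < aP) : (probeModel q cJ c₂ δ aP haP).xiJ = cJ * aP := by
  simp only [EndgameData.xiJ, probeModel, Finset.univ_unique, Finset.sum_singleton, one_mul,
    Complex.norm_real, Real.norm_of_nonneg (Real.sqrt_nonneg _), Real.sq_sqrt hcJ]

/-- `Ξ₁₂ = c₂·𝔞𝔓`. [folklore] -/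
theorem probeModel_xi12 (hc₂ : 0 ≤ c₂) (haP : 0 < aP) : (probeModel q cJ c₂ δ aP haP).xi12 = c₂ * aP := by
  simp only [EndgameData.xi12, probeModel, Finset.univ_unique, Finset.sum_singleton, one_mul,
    Complex.norm_real, Real.norm_of_nonneg (Real.sqrt_nonneg _), Real.sq_sqrt hc₂]

/-- `J₁ − ZJ̄₂ = −√δ` for the probe datum. [folklore] -/
theorem probeModel_defect (u : Unit) :
    (probeModel q cJ c₂ δ aP haP).J₁ u
        - (probeModel q cJ c₂ δ aP haP).Z u * conj ((probeModel q cJ c₂ δ aP haP).J₂ u)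
      = ((-Real.sqrt δ : ℝ) : ℂ) := by
  simp only [probeModel, Complex.conj_ofReal, one_mul]
  push_cast
  ring

/-- `𝔇_J = δ·𝔞𝔓`. [folklore] -/
theorem probeModel_afeDefectForm (hδ : 0 ≤ δ) (haP : 0 < aP) :
    (probeModel q cJ c₂ δ aP haP).afeDefectForm = δ * aP := by
  simp only [EndgameData.afeDefectForm, Finset.univ_unique, Finset.sum_singleton, probeModel_defect,
    Complex.norm_real, Real.norm_eq_abs, abs_neg, abs_of_nonneg (Real.sqrt_nonneg _), Real.sq_sqrt hδ]
  simp [probeModel]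

/-- `Ξ₃* = √(c₂·δ)·𝔞𝔓` (equality in §11's Cauchy step). [folklore] -/
theorem probeModel_xiStar3 (hc₂ : 0 ≤ c₂) (haP : 0 < aP) :
    (probeModel q cJ c₂ δ aP haP).xiStar3 = Real.sqrt (c₂ * δ) * aP := by
  simp only [EndgameData.xiStar3, Finset.univ_unique, Finset.sum_singleton, probeModel_defect,
    Complex.norm_real, Real.norm_eq_abs, abs_neg, abs_of_nonneg (Real.sqrt_nonneg _)]
  simp only [probeModel, Complex.norm_real, Real.norm_of_nonneg (Real.sqrt_nonneg _), one_mul,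
    Real.sqrt_mul hc₂]
  ring

/-- `Ξ₂* = √(q·c_J)·𝔞𝔓` (equality in the first Cauchy step). [folklore] -/
theorem probeModel_xiStar2 (hq : 0 ≤ q) (haP : 0 < aP) :
    (probeModel q cJ c₂ δ aP haP).xiStar2 = Real.sqrt (q * cJ) * aP := by
  have h : ((Real.sqrt q - Real.sqrt c₂ : ℝ) : ℂ) + 1 * conj (Real.sqrt c₂ : ℂ) = (Real.sqrt q : ℂ) := by
    rw [Complex.conj_ofReal]; push_cast; ring
  simp only [EndgameData.xiStar2, probeModel, Finset.univ_unique, Finset.sum_singleton, one_mul]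
  rw [one_mul] at h
  rw [h, Complex.norm_real, Complex.norm_real, Real.norm_of_nonneg (Real.sqrt_nonneg _),
    Real.norm_of_nonneg (Real.sqrt_nonneg _), Real.sqrt_mul hq]

end ProbeModel

/-- **Consistency.** If `d ≤ √(q·c_J) + √(c₂·δ)` (`q, c_J, c₂, δ ≥ 0`) then a datum obeying Lemma 2.3
and `|Z| = 1` satisfies `|Ξ₁*| ≥ d𝔞𝔓`, `Ξ₁ = q𝔞𝔓`, `Ξ_J = c_J𝔞𝔓`, `Ξ₁₂ = c₂𝔞𝔓`, `𝔇_J = δ𝔞𝔓` at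
once — with `Ξ₃* = √(c₂δ)𝔞𝔓` and (2.18) an equality: from these inputs the skeleton with a free
second probe derives no contradiction. With `EndgameData.false_of_closing_probe`: the generalised
closing condition `√(q·c_J) + √(c₂·δ) < d` is necessary and sufficient. [folklore] -/
theorem exists_consistent_probe {d q cJ c₂ δ aP : ℝ} (hq : 0 ≤ q) (hcJ : 0 ≤ cJ) (hc₂ : 0 ≤ c₂)
    (hδ : 0 ≤ δ) (hd : d ≤ Real.sqrt (q * cJ) + Real.sqrt (c₂ * δ)) (haP : 0 < aP) :
    ∃ E : EndgameData Unit,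
      d * aP ≤ ‖E.xiStar1‖ ∧ E.xi1 = q * aP ∧ E.xiJ = cJ * aP ∧ E.xi12 = c₂ * aP
        ∧ E.afeDefectForm = δ * aP ∧ E.xiStar3 = Real.sqrt (c₂ * δ) * aP
        ∧ ‖E.xiStar1‖ = E.xiStar2 + E.xiStar3 := by
  refine ⟨probeModel q cJ c₂ δ aP haP, ?_, probeModel_xi1 hq haP, probeModel_xiJ hcJ haP,
    probeModel_xi12 hc₂ haP, probeModel_afeDefectForm hδ haP, probeModel_xiStar3 hc₂ haP, ?_⟩
  · rw [probeModel_norm_xiStar1 hq hc₂ haP]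
    exact mul_le_mul_of_nonneg_right hd haP.le
  · rw [probeModel_norm_xiStar1 hq hc₂ haP, probeModel_xiStar2 hq haP, probeModel_xiStar3 hc₂ haP]
    ring

/-- In particular for the values that matter (`d ≤ √(q·c_J) + √(c₂·δ)` is what the polar provenance
of main-order constants always gives, `MainTermFormProbePair.le_of_probePair_thresholds`): freeing
the second probe of (2.30) — any shift, length or smoothing of `J₂`, or `J₂ = 0` — changes the
tolerance of the skeleton from Proposition 2.6's `o(𝔞𝔓)` to `√(c₂δ)𝔞𝔓` and the target from
`√(q·c_J) < d` to `√(q·c_J) + √(c₂·δ) < d`, and the skeleton is consistent whenever the latter fails.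
[folklore] -/
theorem exists_consistent_probe_of_not_closing {d q cJ c₂ δ aP : ℝ} (hq : 0 ≤ q) (hcJ : 0 ≤ cJ)
    (hc₂ : 0 ≤ c₂) (hδ : 0 ≤ δ) (hM : ¬ (Real.sqrt (q * cJ) + Real.sqrt (c₂ * δ) < d))
    (haP : 0 < aP) :
    ∃ E : EndgameData Unit,
      d * aP ≤ ‖E.xiStar1‖ ∧ E.xi1 = q * aP ∧ E.xiJ = cJ * aP ∧ E.xi12 = c₂ * aP
        ∧ E.afeDefectForm = δ * aP ∧ E.xiStar3 = Real.sqrt (c₂ * δ) * aP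
        ∧ ‖E.xiStar1‖ = E.xiStar2 + E.xiStar3 :=
  exists_consistent_probe hq hcJ hc₂ hδ (not_lt.mp hM) haP

end Literature.NumberTheory.LFunctions.Zhang2022
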